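/-
Copyright (c) 2026 the pub-hodgecm-mathlib formalisation cell (harness21).  Prover seat hodgecm-mathlib-LH7-p10 (g2), req620 Track A «(D-RAM) FOUR-FRAME» squad
((β₂) road (R-36) «PURE-CELL LEDGER», lane C = type RamM: the `hEvenRowC` socket of LH4-p12 (g8)'s ★ p863526 (OFF_C) dispatch — «AT ODD `d` THE `m_E`-EVEN ROW IS OFF THE
LEVEL-1 SHELL» inside the anti-diagonal, and EMPTY short of it), 2026-09-05.
-/
import Summits.HodgeConjecture.HodgeConjecture.Theorems.F0P3cDyRamConeCellPresentation        -- ★ p862869 (LH7-p09 (g2)): the JUNCTION `exists_presentation_of_mem_levelSetDep`; brings ★ `…ShellLineModel`, ★ DEFS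
import Summits.HodgeConjecture.HodgeConjecture.Theorems.F0P3cDyRamRowCellOnShell              -- ★ p863084 (LH4-p06 (g9)): `not_isOrd_div_mul_of_row` (a row vertex inside the anti-diagonal is on level EXACTLY 0 — size tokens only)
import Summits.HodgeConjecture.HodgeConjecture.Theorems.F0P3cDyRamBeta2ConesRowWindowCBridge   -- ★ p863549 (this seat): the lane-C bridge (change of generator, unit bridge, (W0)_C)
import Summits.HodgeConjecture.HodgeConjecture.Theorems.F0P3cDyRamConeCellEmptyAtlas            -- ★ p861798 (this base, g0): brings ★ p861746 §0 `finsum_inter_sub_finsum_inter_eq_zero_of_eq_empty`, ★ p861491 `levelSetDep_eq_empty_of_lt_add_ramM`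
import HarnessLib

/-!
# Crux `H413`, line LH4 «(D-RAM) FOUR-FRAME» — the (β₂) road (R-36), lane C (type RamM), socket `hEvenRowC` of LH4-p12 (g8)'s (OFF_C) dispatch ★ p863526:
# «AT ODD `d` THE `m_E`-EVEN ROW `m = 4b` OF THE RamM CONE LEDGER CONTRIBUTES ZERO» away from its anti-diagonal corner — inside the anti-diagonal every glued vertex is on level
# EXACTLY `0` (★ `not_isOrd_div_mul_of_row`), so no vertex carries a level-`1` label; short of the anti-diagonal the cone cell is empty (★ `levelSetDep_eq_empty_of_lt_add_ramM`)

Cell `hodgecm-mathlib` (D-0151), FLOOR 0, crux item H413 = `stmt-HodgeConjecture-24833`, route of record `HCCMUnconditional`; squads F0∕P3c∕LH4 + LH7; lane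
`--supports stmt-HodgeConjecture-24833 --as helper` (count-neutral; pays NO tier-0 row).  THEOREMS ONLY (no `def`, no instance, no notation, no `sorry`, default heartbeats);
★-only imports; states NO law; (β₂) stays a HYPOTHESIS.  DATUM-FREE: ★ p861044∕p861305's block frame in the GENERAL-BLOCK spelling `(H₂, h_W, γ₂, u, φ, h, f)` of ‹OFF_C.letter.v2›
(one theorem serves both literals), the line model with `jE` RAMIFIED (`c1 : |jE a| = |a|²`; the RamM place package's `c5 c6 c7`: `|α − ρα| = exp(−d_ρ)`), ★ DEFS `levelSetDep`.

WHY (LH4-p12 (g8)'s ★ p863526 `cellDiff_offRowC_eq_zero_of_pieces`, socket `hEvenRowC : ∀ j b, 1 ≤ b → b ≤ j → d % 2 = 1 → m = 4 * b → ‹live› → lam ∈ 𝒪_j → cellDiff(j, b) = 0`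
— «odd `d` only: the cells `m = 4b`, the even-parity row, off the live row `4b + 2`»).  In lane B the analogous row `2b = m` at odd `d` is killed by parity (★ `depth_mod_two_eq`:
`m ≡ d`); in lane C the depth is always even (★ p863622 `depth_even_ramM`) and `m = 4b`, i.e. `m_E = 2b`, IS a row of cone cells at odd `d` — but its vertices are ROW vertices:
`|μ| = exp(−4b) = |jE ϖ|^{2b}` EXACTLY, so by LH4-p06 (g9)'s ★ `not_isOrd_div_mul_of_row` (size tokens only, any `q`, Gram-primitivity from the junction) every glued vertex strictly
inside the anti-diagonal (`|μ − ρμ| ≤ |cc(α − ρα)|·|jE ϖ|^{b+1}`, i.e. `2j + d_ρ + 2b + 2 ≤ jl`) has its depth quotient `κ_Λ = μ∕Y` in `𝒪_cc` but `κ_Λ∕jE ϖ ∉ 𝒪_cc` — level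
EXACTLY `0` (★ `…ShellLineModel.latticeNearTransvShell_endoGL_sub_one_iff_isOrd`, third clause at level `1`), whereas at odd `d` BOTH labels of the letter ask for the shell level
`ℓ₀ = d % 2 = 1`: both labelled subsets are EMPTY.  Short of the anti-diagonal (`jl < 2j + d_ρ + 2b`, i.e. `jl_E < j + b` with `m_E = 2b ≤ jl_E`, ★ p863549's unit bridge) the cone
cell itself is empty (★ `levelSetDep_eq_empty_of_lt_add_ramM` at the datum uniformiser, moved to `α` by ★ `levelSetDep_eq_levelSetDep_varpiM`).
* §1 FOLD `levelSetDep_inter_shell_eq_empty_of_evenRow_ramM` — junction letters + `c1 c5 c6 c7`; tokens `hm hjl`; `m = 4b`, `1 ≤ b ≤ j`, `2j + d_ρ + 2b + 2 ≤ jl`; shell level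
  `ℓ = 1`, ANY square level `k`, ANY trailing predicate `P` ⟹ the shell-cut subset of `levelSetDep(j, b; μ)` is `∅`.
* §2 HEADS in ‹OFF_C.letter.v2›'s one-literal currency (`X(j, b)` VERBATIM): (ER-deep) `cellDiff_evenRow_eq_zero_of_deep_ramM` (`d % 2 = 1`, `1 ≤ b ≤ j`, `m = 4b`,
  `2j + d_ρ + 2b + 2 ≤ jl`, `lam ∈ 𝒪_j`) and (ER-short) `cellDiff_evenRow_eq_zero_of_lt_ramM` (`m = 4b`, `jl < 2j + d_ρ + 2b`, `lam ∈ 𝒪_j`; any parity of `d`, any `b`).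
WHAT IS NOT CLAIMED.  THE CORNER `jl = 2j + d_ρ + 2b` of the row (`jl_E = j + b`: the vertex sits ON the anti-diagonal, where ★ `not_isOrd_div_mul_of_row`'s strict domination is not
available) — after this file LH4-p12's `hEvenRowC` shrinks to exactly that corner; any census law.
HONEST LABEL.  Count-neutral lattice bookkeeping; nothing printed is asserted; `HC_CM` is proved only modulo the 7 printed citations (2 remaining named inputs: hLiu418 =
`stmt-HodgeConjecture-24832`, h413 = `stmt-HodgeConjecture-24833`) until rung 0 closes.
## References
* [Kottwitz1986BaseChangeUnits] R. E. Kottwitz, *Base change for unit elements of Hecke algebras*, Compositio Math. 60 (1986): §1 pp. 240–241, §3 (congruence levels on lattices).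
* [Jacobowitz1962] R. Jacobowitz, *Hermitian forms over local fields*, Amer. J. Math. 84 (1962): §4 (duals, Gram-primitivity, gluing).
* [Serre1979] J.-P. Serre, *Local Fields*, GTM 67 (1979): Ch. III §6 Prop. 12 (orders of conductor `c`).
* [Rogawski1990] J. D. Rogawski, *Automorphic Representations of Unitary Groups in Three Variables*, Ann. of Math. Stud. 123 (1990): §4.9 Prop. 4.9.1 (b) p. 55.
-/

set_option autoImplicit false

noncomputable section

namespace Summit.HodgeConjecture.HodgeConjecture.Cruxes.H413.F0P3cDyRamEvenRowRamM

open scoped Valued WithZero Matrix MatrixGroups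
open WithZero
open Literature.NumberTheory.Automorphic Literature.NumberTheory.Automorphic.HermitianLattice Literature.NumberTheory.Automorphic.UnitaryLatticeTree
open Literature.NumberTheory.Automorphic.UnitaryThreeFourFrame (IsRamifiedQuadraticDatum)
open Literature.NumberTheory.Rogawski1990
open Summit.HodgeConjecture.HodgeConjecture.Cruxes.H413.F0P3cDyRamToricCensusDefs
open Summit.HodgeConjecture.HodgeConjecture.Cruxes.H413.F0P3cDyRamFourFramePieces
open Summit.HodgeConjecture.HodgeConjecture.Cruxes.H413.F0P3cDyRamFourFrameCensusDefs (LatticeInLevel LatticeNearTransvShell)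
open Summit.HodgeConjecture.HodgeConjecture.Cruxes.H413.F0P3cDyRamStageOneBDefs (mcOfRecord)
open Summit.HodgeConjecture.HodgeConjecture.Cruxes.H413.F0P3cDyRamConeCellPresentation (exists_presentation_of_mem_levelSetDep)
open Summit.HodgeConjecture.HodgeConjecture.Cruxes.H413.F0P3cDyRamShellLineModel (latticeNearTransvShell_endoGL_sub_one_iff_isOrd)
open Summit.HodgeConjecture.HodgeConjecture.Cruxes.H413.F0P3cDyRamRowCellOnShell (not_isOrd_div_mul_of_row)
open Summit.HodgeConjecture.HodgeConjecture.Cruxes.H413.F0P3cDyRamConeCellBoundaryEmptyAtTwo (finsum_inter_sub_finsum_inter_eq_zero_of_eq_empty)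
open Summit.HodgeConjecture.HodgeConjecture.Cruxes.H413.F0P3cDyRamConeCellLedgerSizesRamM (levelSetDep_eq_empty_of_lt_add_ramM)
open Summit.HodgeConjecture.HodgeConjecture.Cruxes.H413.F0P3cDyRamBeta2ConesRowWindowCBridge (v_map_varpi_eq levelSetDep_eq_levelSetDep_varpiM exists_jl_eq_two_mul_add v_mu_eq_pow
  v_mu_sub_eq_mul half_m_le_half_jl isOrd_lam_iff_le_ramM)

variable {E M : Type} [Field E] [Valued E ℤᵐ⁰] [Field M] [Valued M ℤᵐ⁰] {ρ Θ : M →+* M} {α : M}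

/-! ## §1 FOLD — at the `m_E`-even row, inside the anti-diagonal, no glued vertex is on a level-`1` shell -/

/-- **FOLD, RamM LANE — «INSIDE THE ANTI-DIAGONAL THE ROW `m = 4b` HAS NO VERTEX ON ANY LEVEL-`1` SHELL»** (any `q`, any square level `k`, any trailing predicate `P`).  Block frame +
line model (the junction's letters VERBATIM; `c1 c5 c6 c7` for `|jE ϖ| = exp(−2)`, `|α − ρα| = exp(−d_ρ)`); cone cell `(j, b)` with `1 ≤ b ≤ j`, `lam ∈ 𝒪_j`; the ‹OFF_C› tokens
`hm : |μ| = exp(−m)`, `hjl : |μ − ρμ| = exp(−jl)` with `m = 4b` (the row: `|μ| = |jE ϖ|^{2b}` exactly) and `2j + d_ρ + 2b + 2 ≤ jl` (strictly inside the anti-diagonal: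
`|μ − ρμ| ≤ |cc(α − ρα)|·|jE ϖ|^{b+1}`); shell level `ℓ = 1`.  THEN the subset of `levelSetDep(j, b; μ)` cut out by `∃ B, φ B = Λ ∧ ∃ L₃, SD ∧ L₃ ∩ W = ι_W B ∧ tube_b ∧
(LatticeNearTransvShell ϖ ℓ k (Γ − 1) L₃ ∧ P L₃)` is `∅`: the junction ★ p862869 presents the vertex with a Gram-primitive `Y`, ★ `not_isOrd_div_mul_of_row` puts `μ∕(jE ϖ·Y)` outside
`𝒪_cc`, and that is the third clause of level `1` in ★ `latticeNearTransvShell_endoGL_sub_one_iff_isOrd`. [cite: Kottwitz1986BaseChangeUnits, §1 pp. 240–241, §3] [cite: Jacobowitz1962, §4]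
[cite: Serre1979, Ch. III §6 Prop. 12] -/
theorem levelSetDep_inter_shell_eq_empty_of_evenRow_ramM
    (σ : E →+* E) (hσ : ∀ a, σ (σ a) = a) (hvσ : ∀ a, Valued.v (σ a) = Valued.v a) {ϖ : E} (hϖ : Valued.v ϖ = exp (-1 : ℤ))
    {H₂ : Matrix (Fin 2) (Fin 2) E} (hH₂ : IsUnit H₂.det) (hH₂σ : (H₂.map σ)ᵀ = H₂) {hW : E} (hhW : Valued.v hW = 1)
    (jE : E →+* M) (hρρ : ∀ x, ρ (ρ x) = x) (hvρ : ∀ x, Valued.v (ρ x) = Valued.v x) (hα : ρ α ≠ α) (hα1 : Valued.v α ≤ 1)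
    (hint : ∀ z : M, Valued.v z ≤ 1 → Valued.v ((z - ρ z) / (α - ρ α)) ≤ 1)
    (hΘΘ : ∀ x, Θ (Θ x) = x) (hΘρ : ∀ x, Θ (ρ x) = ρ (Θ x)) (hvΘ : ∀ x, Valued.v (Θ x) = Valued.v x)
    (hjv : ∀ c, Valued.v (jE c) ≤ 1 ↔ Valued.v c ≤ 1) (hjfix : ∀ z, ρ z = z ↔ ∃ c, jE c = z)
    (hjpow : ∀ (t : E) (n : ℤ), Valued.v (jE t) = Valued.v (jE ϖ) ^ n ↔ Valued.v t = Valued.v ϖ ^ n)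
    (hϖmax : ∀ t : M, ρ t = t → Valued.v t < 1 → Valued.v t ≤ Valued.v (jE ϖ)) (hjϖ : Valued.v (jE ϖ) = exp (-2 : ℤ))
    (φ : (Fin 2 → E) →+ M) (hφs : ∀ (c : E) (x : Fin 2 → E), φ (c • x) = jE c * φ x) (hφi : Function.Injective φ) (hφo : Function.Surjective φ)
    {γ₂ : GL (Fin 2) E} {lam h : M} (hφγ : ∀ x, φ ((γ₂ : Matrix (Fin 2) (Fin 2) E).mulVec x) = lam * φ x) (hlam : Valued.v lam = 1)
    (hΘh : Θ h = h) (hh : h ≠ 0) (hform : ∀ x y, jE (pairing σ H₂ x y) = h * Θ (φ x) * φ y + ρ (h * Θ (φ x) * φ y))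
    (u : GL (Fin 1) E) {b j : ℕ} (hb1 : 1 ≤ b) (hbj : b ≤ j) (hlamj : IsOrd ρ α (jE ϖ ^ j) lam) {m jl dρ : ℕ}
    (hm : Valued.v (lam - jE ((u : Matrix (Fin 1) (Fin 1) E) 0 0)) = WithZero.exp (-(m : ℤ)))
    (hjl : Valued.v ((lam - jE ((u : Matrix (Fin 1) (Fin 1) E) 0 0)) - ρ (lam - jE ((u : Matrix (Fin 1) (Fin 1) E) 0 0))) = WithZero.exp (-(jl : ℤ)))
    (hαρ : Valued.v (α - ρ α) = WithZero.exp (-(dρ : ℤ)))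
    (hmb : m = 4 * b) (hdeep : 2 * j + dρ + 2 * b + 2 ≤ jl) (ℓ : ℕ) (hℓ : ℓ = 1) (k : ℕ) (P : Submodule 𝒪[E] (Fin 3 → E) → Prop) :
    levelSetDep ρ Θ α (jE ϖ) h j b (lam - jE ((u : Matrix (Fin 1) (Fin 1) E) 0 0)) ∩
        {Λ | ∃ B : Submodule 𝒪[E] (Fin 2 → E), B.toAddSubgroup.map φ = Λ ∧
          ∃ L₃ : Submodule 𝒪[E] (Fin 3 → E), IsSelfDualLattice σ ϖ (!![H₂ 0 0, 0, H₂ 0 1; 0, hW, 0; H₂ 1 0, 0, H₂ 1 1] : Matrix (Fin 3) (Fin 3) E) L₃ ∧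
            L₃ ⊓ LinearMap.ker ((LinearMap.proj (1 : Fin 3) : (Fin 3 → E) →ₗ[E] E).restrictScalars 𝒪[E]) =
              B.map ((Matrix.toLin' (!![1, 0; 0, 0; 0, 1] : Matrix (Fin 3) (Fin 2) E)).restrictScalars 𝒪[E]) ∧
            (∀ c : E, (Pi.single 1 c : Fin 3 → E) ∈ L₃ ↔ Valued.v c ≤ Valued.v ϖ ^ b) ∧
            (LatticeNearTransvShell ϖ ℓ k ((((endoGL (γ₂, u) : GL (Fin 3) E) : Matrix (Fin 3) (Fin 3) E) - 1)) L₃ ∧ P L₃)} = ∅ := by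
  subst hℓ
  have hjϖ0 : jE ϖ ≠ 0 := fun h0 => by rw [h0, map_zero] at hjϖ; exact zero_ne_coe hjϖ
  have hjϖle : Valued.v (jE ϖ) ≤ 1 := by rw [hjϖ, ← exp_zero, exp_le_exp]; norm_num
  have hPn : ∀ n : ℕ, Valued.v (jE ϖ) ^ n = exp (-(2 * (n : ℤ))) := fun n => by
    rw [hjϖ, ← exp_nsmul]; congr 1; simp only [nsmul_eq_mul]; ring
  have hρϖ : ρ (jE ϖ) = jE ϖ := (hjfix _).2 ⟨ϖ, rfl⟩
  -- the row letters in `|jE ϖ|^·`-currency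
  have hμ' : Valued.v (lam - jE ((u : Matrix (Fin 1) (Fin 1) E) 0 0)) = Valued.v (jE ϖ) ^ (2 * b) := by
    rw [hm, hPn]; congr 1; push_cast; omega
  have hcb : Valued.v (jE ϖ ^ j) ≤ Valued.v (jE ϖ) ^ b := by rw [map_pow]; exact pow_le_pow_right_of_le_one' hjϖle hbj
  have hanti : Valued.v ((lam - jE ((u : Matrix (Fin 1) (Fin 1) E) 0 0)) - ρ (lam - jE ((u : Matrix (Fin 1) (Fin 1) E) 0 0))) ≤
      Valued.v (jE ϖ ^ j * (α - ρ α)) * Valued.v (jE ϖ) ^ (b + 1) := by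
    rw [hjl, map_mul, map_pow, hPn, hαρ, hPn, ← exp_add, ← exp_add, exp_le_exp]; push_cast; omega
  refine Set.subset_empty_iff.1 fun Λ hΛ => ?_
  obtain ⟨hΛ, B, hBΛ, L₃, hL, hLB, htube, hshell, -⟩ := hΛ
  obtain ⟨x₀, w₀, g₀, hx₀, hΛx, hYO, hYprim, hylev, hw₀Y, hpr, hg₀, hg₀1, hprg⟩ :=
    exists_presentation_of_mem_levelSetDep σ hσ hvσ hϖ hH₂ hH₂σ hhW jE hρρ hvρ hα hα1 hint hΘΘ hΘρ hvΘ hjv hjfix hjpow hϖmax φ hφs hφi hφo hφγ hlam hΘh hh hform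
      ((u : Matrix (Fin 1) (Fin 1) E) 0 0) hb1 hlamj hΛ hBΛ hL hLB htube
  have hY0 : dualGen ρ Θ α (jE ϖ ^ j) h x₀ ≠ 0 := fun h0 => by
    rw [h0, map_zero] at hylev; exact pow_ne_zero b ((Valuation.ne_zero_iff _).2 hjϖ0) hylev.symm
  -- the third clause of level `1`: `μ ∕ (jE ϖ · Y) ∈ 𝒪_cc` — denied on the row inside the anti-diagonal
  have h1 := ((latticeNearTransvShell_endoGL_sub_one_iff_isOrd hvρ hϖ jE φ hφs hφi hφγ htube hpr hLB.symm hg₀ hg₀1 hprg hBΛ hx₀ hY0 hΛx hw₀Y u 1 k).1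
    hshell).1.2.2
  rw [pow_one] at h1
  exact not_isOrd_div_mul_of_row hvρ hα hα1 jE hjv hϖ hρϖ hYO hYprim hb1 hylev hcb hμ' hanti h1

/-! ## §2 HEADS — socket `hEvenRowC` in ‹OFF_C.letter.v2›'s one-literal currency, away from the corner -/

/-- **(ER-deep) «AT ODD `d`, INSIDE THE ANTI-DIAGONAL, A CELL OF THE ROW `m = 4b` CONTRIBUTES ZERO»** — letters `d % 2 = 1`, `1 ≤ b`, `b ≤ j`, `m = 4 * b`, `2j + d_ρ + 2b + 2 ≤ jl`,
`lam ∈ 𝒪_j` after ‹OFF_C›'s frame (general block; `c1 c5 c6 c7` for the lane-C weights): both labelled subsets of `X(j, b)` ask for the shell level `d % 2 = 1` and are `∅` by §1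
(`+` at square level `m⋆`, `−′` at `m_c`), so both finsums vanish. [cite: Kottwitz1986BaseChangeUnits, §1 pp. 240–241, §3] [cite: Rogawski1990, §4.9 Prop. 4.9.1 (b) p. 55] -/
theorem cellDiff_evenRow_eq_zero_of_deep_ramM
    (σ : E →+* E) {ϖ : E} {d tE : ℕ} (hD : IsRamifiedQuadraticDatum σ ϖ d tE)
    {H₂ : Matrix (Fin 2) (Fin 2) E} (hH₂ : IsUnit H₂.det) (hH₂σ : (H₂.map σ)ᵀ = H₂) {hW : E} (hhW : Valued.v hW = 1)
    (jE : E →+* M) (hρρ : ∀ x, ρ (ρ x) = x) (hvρ : ∀ x, Valued.v (ρ x) = Valued.v x) (hα : ρ α ≠ α) (hα1 : Valued.v α ≤ 1)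
    (hint : ∀ z : M, Valued.v z ≤ 1 → Valued.v ((z - ρ z) / (α - ρ α)) ≤ 1)
    (hΘΘ : ∀ x, Θ (Θ x) = x) (hΘρ : ∀ x, Θ (ρ x) = ρ (Θ x)) (hvΘ : ∀ x, Valued.v (Θ x) = Valued.v x)
    (hjv : ∀ c, Valued.v (jE c) ≤ 1 ↔ Valued.v c ≤ 1) (hjfix : ∀ z, ρ z = z ↔ ∃ c, jE c = z)
    (hjpow : ∀ (t : E) (n : ℤ), Valued.v (jE t) = Valued.v (jE ϖ) ^ n ↔ Valued.v t = Valued.v ϖ ^ n)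
    (hϖmax : ∀ t : M, ρ t = t → Valued.v t < 1 → Valued.v t ≤ Valued.v (jE ϖ))
    (c1 : ∀ a, Valued.v (jE a) = Valued.v a ^ 2) {ϖM : M} {dρ : ℕ} (c5 : Valued.v ϖM = WithZero.exp (-1 : ℤ)) (c6 : α - ρ α = ϖM - ρ ϖM)
    (c7 : IsRamifiedQuadraticDatum ρ ϖM dρ (2 * tE))
    (φ : (Fin 2 → E) →+ M) (hφs : ∀ (c : E) (x : Fin 2 → E), φ (c • x) = jE c * φ x) (hφi : Function.Injective φ) (hφo : Function.Surjective φ)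
    {γ₂ : GL (Fin 2) E} {lam h : M} (hφγ : ∀ x, φ ((γ₂ : Matrix (Fin 2) (Fin 2) E).mulVec x) = lam * φ x) (hlam : Valued.v lam = 1)
    (hΘh : Θ h = h) (hh : h ≠ 0) (hform : ∀ x y, jE (pairing σ H₂ x y) = h * Θ (φ x) * φ y + ρ (h * Θ (φ x) * φ y))
    (u : GL (Fin 1) E)
    {m jl : ℕ} (hm : Valued.v (lam - jE ((u : Matrix (Fin 1) (Fin 1) E) 0 0)) = WithZero.exp (-(m : ℤ)))
    (hjl : Valued.v ((lam - jE ((u : Matrix (Fin 1) (Fin 1) E) 0 0)) - ρ (lam - jE ((u : Matrix (Fin 1) (Fin 1) E) 0 0))) = WithZero.exp (-(jl : ℤ)))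
    (f : ℕ → ℕ → AddSubgroup M → ℕ) (j b : ℕ) (hd1 : d % 2 = 1) (hb1 : 1 ≤ b) (hbj : b ≤ j) (hmb : m = 4 * b)
    (hdeep : 2 * j + dρ + 2 * b + 2 ≤ jl) (hlamj : IsOrd ρ α (jE ϖ ^ j) lam) :
    ((∑ᶠ Λ ∈ levelSetDep ρ Θ α (jE ϖ) h j b (lam - jE ((u : Matrix (Fin 1) (Fin 1) E) 0 0)) ∩
                      {Λ | ∃ B : Submodule 𝒪[E] (Fin 2 → E), B.toAddSubgroup.map φ = Λ ∧
                        ∃ L₃ : Submodule 𝒪[E] (Fin 3 → E), IsSelfDualLattice σ ϖ (!![H₂ 0 0, 0, H₂ 0 1; 0, hW, 0; H₂ 1 0, 0, H₂ 1 1] : Matrix (Fin 3) (Fin 3) E) L₃ ∧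
                          L₃ ⊓ LinearMap.ker ((LinearMap.proj (1 : Fin 3) : (Fin 3 → E) →ₗ[E] E).restrictScalars 𝒪[E]) =
                            B.map ((Matrix.toLin' (!![1, 0; 0, 0; 0, 1] : Matrix (Fin 3) (Fin 2) E)).restrictScalars 𝒪[E]) ∧
                          (∀ c : E, (Pi.single 1 c : Fin 3 → E) ∈ L₃ ↔ Valued.v c ≤ Valued.v ϖ ^ b) ∧
                          (LatticeNearTransvShell ϖ (d % 2) (mstarOfRecord d) ((((endoGL (γ₂, u) : GL (Fin 3) E) : Matrix (Fin 3) (Fin 3) E) - 1)) L₃ ∧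
                            {z : E | ∃ y ∈ L₃, Valued.v ((ϖ ^ (mstarOfRecord d))⁻¹ * (z - pairing σ (!![H₂ 0 0, 0, H₂ 0 1; 0, hW, 0; H₂ 1 0, 0, H₂ 1 1] : Matrix (Fin 3) (Fin 3) E) y (((((endoGL (γ₂, u) : GL (Fin 3) E) : Matrix (Fin 3) (Fin 3) E) - 1)) *ᵥ y))) ≤ 1} =
                              valueSetMod σ ϖ (mstarOfRecord d) (xPlus σ ϖ d))}, f b j Λ : ℕ) : ℤ) -
                  ((∑ᶠ Λ ∈ levelSetDep ρ Θ α (jE ϖ) h j b (lam - jE ((u : Matrix (Fin 1) (Fin 1) E) 0 0)) ∩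
                      {Λ | ∃ B : Submodule 𝒪[E] (Fin 2 → E), B.toAddSubgroup.map φ = Λ ∧
                        ∃ L₃ : Submodule 𝒪[E] (Fin 3 → E), IsSelfDualLattice σ ϖ (!![H₂ 0 0, 0, H₂ 0 1; 0, hW, 0; H₂ 1 0, 0, H₂ 1 1] : Matrix (Fin 3) (Fin 3) E) L₃ ∧
                          L₃ ⊓ LinearMap.ker ((LinearMap.proj (1 : Fin 3) : (Fin 3 → E) →ₗ[E] E).restrictScalars 𝒪[E]) =
                            B.map ((Matrix.toLin' (!![1, 0; 0, 0; 0, 1] : Matrix (Fin 3) (Fin 2) E)).restrictScalars 𝒪[E]) ∧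
                          (∀ c : E, (Pi.single 1 c : Fin 3 → E) ∈ L₃ ↔ Valued.v c ≤ Valued.v ϖ ^ b) ∧
                          (LatticeNearTransvShell ϖ (d % 2) (mcOfRecord d) ((((endoGL (γ₂, u) : GL (Fin 3) E) : Matrix (Fin 3) (Fin 3) E) - 1)) L₃ ∧
                            ¬ {z : E | ∃ y ∈ L₃, Valued.v ((ϖ ^ (mstarOfRecord d))⁻¹ * (z - pairing σ (!![H₂ 0 0, 0, H₂ 0 1; 0, hW, 0; H₂ 1 0, 0, H₂ 1 1] : Matrix (Fin 3) (Fin 3) E) y (((((endoGL (γ₂, u) : GL (Fin 3) E) : Matrix (Fin 3) (Fin 3) E) - 1)) *ᵥ y))) ≤ 1} =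
                              valueSetMod σ ϖ (mstarOfRecord d) (xPlus σ ϖ d))}, f b j Λ : ℕ) : ℤ) = 0 := by
  obtain ⟨hσ, hvσ, hϖ, -, -, -, -⟩ := id hD
  have hjϖ : Valued.v (jE ϖ) = exp (-2 : ℤ) := by rw [c1, hϖ, ← exp_nsmul]; congr 1
  have hαρ : Valued.v (α - ρ α) = exp (-(dρ : ℤ)) := by rw [c6, c7.2.2.2.2.1, c5, ← exp_nsmul]; simp
  have hplus : levelSetDep ρ Θ α (jE ϖ) h j b (lam - jE ((u : Matrix (Fin 1) (Fin 1) E) 0 0)) ∩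
                      {Λ | ∃ B : Submodule 𝒪[E] (Fin 2 → E), B.toAddSubgroup.map φ = Λ ∧
                        ∃ L₃ : Submodule 𝒪[E] (Fin 3 → E), IsSelfDualLattice σ ϖ (!![H₂ 0 0, 0, H₂ 0 1; 0, hW, 0; H₂ 1 0, 0, H₂ 1 1] : Matrix (Fin 3) (Fin 3) E) L₃ ∧
                          L₃ ⊓ LinearMap.ker ((LinearMap.proj (1 : Fin 3) : (Fin 3 → E) →ₗ[E] E).restrictScalars 𝒪[E]) =
                            B.map ((Matrix.toLin' (!![1, 0; 0, 0; 0, 1] : Matrix (Fin 3) (Fin 2) E)).restrictScalars 𝒪[E]) ∧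
                          (∀ c : E, (Pi.single 1 c : Fin 3 → E) ∈ L₃ ↔ Valued.v c ≤ Valued.v ϖ ^ b) ∧
                          (LatticeNearTransvShell ϖ (d % 2) (mstarOfRecord d) ((((endoGL (γ₂, u) : GL (Fin 3) E) : Matrix (Fin 3) (Fin 3) E) - 1)) L₃ ∧
                            {z : E | ∃ y ∈ L₃, Valued.v ((ϖ ^ (mstarOfRecord d))⁻¹ * (z - pairing σ (!![H₂ 0 0, 0, H₂ 0 1; 0, hW, 0; H₂ 1 0, 0, H₂ 1 1] : Matrix (Fin 3) (Fin 3) E) y (((((endoGL (γ₂, u) : GL (Fin 3) E) : Matrix (Fin 3) (Fin 3) E) - 1)) *ᵥ y))) ≤ 1} =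
                              valueSetMod σ ϖ (mstarOfRecord d) (xPlus σ ϖ d))} = ∅ :=
    levelSetDep_inter_shell_eq_empty_of_evenRow_ramM σ hσ hvσ hϖ hH₂ hH₂σ hhW jE hρρ hvρ hα hα1 hint hΘΘ hΘρ hvΘ hjv hjfix hjpow hϖmax hjϖ φ hφs hφi hφo hφγ hlam hΘh hh
      hform u hb1 hbj hlamj hm hjl hαρ hmb hdeep (d % 2) hd1 _ _
  have hminus : levelSetDep ρ Θ α (jE ϖ) h j b (lam - jE ((u : Matrix (Fin 1) (Fin 1) E) 0 0)) ∩
                      {Λ | ∃ B : Submodule 𝒪[E] (Fin 2 → E), B.toAddSubgroup.map φ = Λ ∧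
                        ∃ L₃ : Submodule 𝒪[E] (Fin 3 → E), IsSelfDualLattice σ ϖ (!![H₂ 0 0, 0, H₂ 0 1; 0, hW, 0; H₂ 1 0, 0, H₂ 1 1] : Matrix (Fin 3) (Fin 3) E) L₃ ∧
                          L₃ ⊓ LinearMap.ker ((LinearMap.proj (1 : Fin 3) : (Fin 3 → E) →ₗ[E] E).restrictScalars 𝒪[E]) =
                            B.map ((Matrix.toLin' (!![1, 0; 0, 0; 0, 1] : Matrix (Fin 3) (Fin 2) E)).restrictScalars 𝒪[E]) ∧
                          (∀ c : E, (Pi.single 1 c : Fin 3 → E) ∈ L₃ ↔ Valued.v c ≤ Valued.v ϖ ^ b) ∧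
                          (LatticeNearTransvShell ϖ (d % 2) (mcOfRecord d) ((((endoGL (γ₂, u) : GL (Fin 3) E) : Matrix (Fin 3) (Fin 3) E) - 1)) L₃ ∧
                            ¬ {z : E | ∃ y ∈ L₃, Valued.v ((ϖ ^ (mstarOfRecord d))⁻¹ * (z - pairing σ (!![H₂ 0 0, 0, H₂ 0 1; 0, hW, 0; H₂ 1 0, 0, H₂ 1 1] : Matrix (Fin 3) (Fin 3) E) y (((((endoGL (γ₂, u) : GL (Fin 3) E) : Matrix (Fin 3) (Fin 3) E) - 1)) *ᵥ y))) ≤ 1} =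
                              valueSetMod σ ϖ (mstarOfRecord d) (xPlus σ ϖ d))} = ∅ :=
    levelSetDep_inter_shell_eq_empty_of_evenRow_ramM σ hσ hvσ hϖ hH₂ hH₂σ hhW jE hρρ hvρ hα hα1 hint hΘΘ hΘρ hvΘ hjv hjfix hjpow hϖmax hjϖ φ hφs hφi hφo hφγ hlam hΘh hh
      hform u hb1 hbj hlamj hm hjl hαρ hmb hdeep (d % 2) hd1 _ _
  rw [hplus, hminus, finsum_mem_empty]
  simp

/-- **(ER-short) «SHORT OF THE ANTI-DIAGONAL A CELL OF THE ROW `m = 4b` IS EMPTY»** (any parity of `d`) — letters `m = 4 * b`, `jl < 2j + d_ρ + 2b`, `lam ∈ 𝒪_j`: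
with ★ p863549's unit bridge (`m = 2m_E`, `jl = 2jl_E + d_ρ`, `m_E ≤ jl_E`; `j ≤ jl_E` from `lam ∈ 𝒪_j` by (W0)_C) the letters read `2b = m_E ≤ jl_E < j + b`, and ★
`levelSetDep_eq_empty_of_lt_add_ramM` (at `ϖM`, moved to `α` by `c6`) empties the whole cone cell, hence `X(j, b) = 0 − 0`. [cite: Kottwitz1986BaseChangeUnits, §1 pp. 240–241]
[cite: Jacobowitz1962, §4] [cite: Serre1979, Ch. III §6 Prop. 12] -/
theorem cellDiff_evenRow_eq_zero_of_lt_ramM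
    {σ : E →+* E} {ϖ : E} {d tE : ℕ} (hD : IsRamifiedQuadraticDatum σ ϖ d tE)
    {H₂ : Matrix (Fin 2) (Fin 2) E} {hW : E}
    {jE : E →+* M} (hρj : ∀ a, ρ (jE a) = jE a) (hint : ∀ z : M, Valued.v z ≤ 1 → Valued.v ((z - ρ z) / (α - ρ α)) ≤ 1)
    (hΘΘ : ∀ x, Θ (Θ x) = x) (hΘρ : ∀ x, Θ (ρ x) = ρ (Θ x)) (hvΘ : ∀ x, Valued.v (Θ x) = Valued.v x)
    (c1 : ∀ a, Valued.v (jE a) = Valued.v a ^ 2) {ϖM : M} {dρ : ℕ} (c5 : Valued.v ϖM = WithZero.exp (-1 : ℤ)) (c6 : α - ρ α = ϖM - ρ ϖM)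
    (c7 : IsRamifiedQuadraticDatum ρ ϖM dρ (2 * tE))
    {φ : (Fin 2 → E) →+ M} {γ₂ : GL (Fin 2) E} {lam h : M} (hvlam : Valued.v lam = 1) (hh : h ≠ 0)
    {u : GL (Fin 1) E} {m jl : ℕ} (hm : Valued.v (lam - jE ((u : Matrix (Fin 1) (Fin 1) E) 0 0)) = WithZero.exp (-(m : ℤ)))
    (hjl : Valued.v ((lam - jE ((u : Matrix (Fin 1) (Fin 1) E) 0 0)) - ρ (lam - jE ((u : Matrix (Fin 1) (Fin 1) E) 0 0))) = WithZero.exp (-(jl : ℤ)))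
    {f : ℕ → ℕ → AddSubgroup M → ℕ} {j b : ℕ} (hmb : m = 4 * b) (hshort : jl < 2 * j + dρ + 2 * b)
    (hlamj : IsOrd ρ α (jE ϖ ^ j) lam) :
    ((∑ᶠ Λ ∈ levelSetDep ρ Θ α (jE ϖ) h j b (lam - jE ((u : Matrix (Fin 1) (Fin 1) E) 0 0)) ∩
                      {Λ | ∃ B : Submodule 𝒪[E] (Fin 2 → E), B.toAddSubgroup.map φ = Λ ∧
                        ∃ L₃ : Submodule 𝒪[E] (Fin 3 → E), IsSelfDualLattice σ ϖ (!![H₂ 0 0, 0, H₂ 0 1; 0, hW, 0; H₂ 1 0, 0, H₂ 1 1] : Matrix (Fin 3) (Fin 3) E) L₃ ∧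
                          L₃ ⊓ LinearMap.ker ((LinearMap.proj (1 : Fin 3) : (Fin 3 → E) →ₗ[E] E).restrictScalars 𝒪[E]) =
                            B.map ((Matrix.toLin' (!![1, 0; 0, 0; 0, 1] : Matrix (Fin 3) (Fin 2) E)).restrictScalars 𝒪[E]) ∧
                          (∀ c : E, (Pi.single 1 c : Fin 3 → E) ∈ L₃ ↔ Valued.v c ≤ Valued.v ϖ ^ b) ∧
                          (LatticeNearTransvShell ϖ (d % 2) (mstarOfRecord d) ((((endoGL (γ₂, u) : GL (Fin 3) E) : Matrix (Fin 3) (Fin 3) E) - 1)) L₃ ∧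
                            {z : E | ∃ y ∈ L₃, Valued.v ((ϖ ^ (mstarOfRecord d))⁻¹ * (z - pairing σ (!![H₂ 0 0, 0, H₂ 0 1; 0, hW, 0; H₂ 1 0, 0, H₂ 1 1] : Matrix (Fin 3) (Fin 3) E) y (((((endoGL (γ₂, u) : GL (Fin 3) E) : Matrix (Fin 3) (Fin 3) E) - 1)) *ᵥ y))) ≤ 1} =
                              valueSetMod σ ϖ (mstarOfRecord d) (xPlus σ ϖ d))}, f b j Λ : ℕ) : ℤ) -
                  ((∑ᶠ Λ ∈ levelSetDep ρ Θ α (jE ϖ) h j b (lam - jE ((u : Matrix (Fin 1) (Fin 1) E) 0 0)) ∩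
                      {Λ | ∃ B : Submodule 𝒪[E] (Fin 2 → E), B.toAddSubgroup.map φ = Λ ∧
                        ∃ L₃ : Submodule 𝒪[E] (Fin 3 → E), IsSelfDualLattice σ ϖ (!![H₂ 0 0, 0, H₂ 0 1; 0, hW, 0; H₂ 1 0, 0, H₂ 1 1] : Matrix (Fin 3) (Fin 3) E) L₃ ∧
                          L₃ ⊓ LinearMap.ker ((LinearMap.proj (1 : Fin 3) : (Fin 3 → E) →ₗ[E] E).restrictScalars 𝒪[E]) =
                            B.map ((Matrix.toLin' (!![1, 0; 0, 0; 0, 1] : Matrix (Fin 3) (Fin 2) E)).restrictScalars 𝒪[E]) ∧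
                          (∀ c : E, (Pi.single 1 c : Fin 3 → E) ∈ L₃ ↔ Valued.v c ≤ Valued.v ϖ ^ b) ∧
                          (LatticeNearTransvShell ϖ (d % 2) (mcOfRecord d) ((((endoGL (γ₂, u) : GL (Fin 3) E) : Matrix (Fin 3) (Fin 3) E) - 1)) L₃ ∧
                            ¬ {z : E | ∃ y ∈ L₃, Valued.v ((ϖ ^ (mstarOfRecord d))⁻¹ * (z - pairing σ (!![H₂ 0 0, 0, H₂ 0 1; 0, hW, 0; H₂ 1 0, 0, H₂ 1 1] : Matrix (Fin 3) (Fin 3) E) y (((((endoGL (γ₂, u) : GL (Fin 3) E) : Matrix (Fin 3) (Fin 3) E) - 1)) *ᵥ y))) ≤ 1} =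
                              valueSetMod σ ϖ (mstarOfRecord d) (xPlus σ ϖ d))}, f b j Λ : ℕ) : ℤ) = 0 := by
  obtain ⟨jlE, hjlE⟩ := exists_jl_eq_two_mul_add c5 c6 c7 hint hm hjl
  have hmE : m = 2 * (2 * b) := by omega
  have hle : 2 * b ≤ jlE := half_m_le_half_jl hD hρj c1 c5 c6 c7 hint hm hjl hmE hjlE
  have hj : j ≤ jlE := by have h := (isOrd_lam_iff_le_ramM hD hρj hvlam c1 c5 c6 c7 hjl j).1 hlamj; omega
  have hempty : levelSetDep ρ Θ α (jE ϖ) h j b (lam - jE ((u : Matrix (Fin 1) (Fin 1) E) 0 0)) = ∅ := by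
    rw [levelSetDep_eq_levelSetDep_varpiM c6]
    exact levelSetDep_eq_empty_of_lt_add_ramM c7 hΘΘ hΘρ hvΘ (hρj ϖ) (v_map_varpi_eq hD c1) hh (v_mu_eq_pow hD c1 hm hmE) (v_mu_sub_eq_mul hD c1 c5 c7 hjl hjlE)
      le_rfl (by omega) (by omega) hj
  exact finsum_inter_sub_finsum_inter_eq_zero_of_eq_empty _ hempty _ _ _

end Summit.HodgeConjecture.HodgeConjecture.Cruxes.H413.F0P3cDyRamEvenRowRamM

end
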